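import Literature.Analysis.FluidPDE.Seregin2020SwirlMoserSliceTools
import HarnessLib

/-!
# Seregin 2020, proof of Thm 2.1: the `ε`-free `L^{10/3}` bound of the Moser step (`ε → 0`)

Analysis/FluidPDE proofs file (theorems only: no definitions, no named facts) on the Moser-iteration
half of the proof of G. Seregin, *Local regularity of axisymmetric solutions to the Navier–Stokes
equations*, Anal. Math. Phys. 10 (2020) Paper 46 = arXiv:2006.04140, Thm 2.1 — the swirl bound (2.6),
which is also Lemma 3.3 / (as1) of Seregin–Šverák 2009 (arXiv:0804.1803, §3 p. 9, App. II). PORT (Literature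
placement, so that Literature files may import it) of the Summits-side helper
`Summits/NavierStokesRegularity/NavierStokesRegularity/Theorems/AxisymmetricExtremalityAxisymmetricKatoGlobalStubSeregin2020TypeIIMoserB.lean`
(namespace `Summit.NavierStokesRegularity.NavierStokesRegularity.Theorems.AxisymmetricKatoGlobal.EulerScaling`,
2026-08-17): statements and proofs verbatim, namespace `Literature.Analysis.FluidPDE.Seregin2020`; the
original is untouched. The printed proof (arXiv p. 6)
removes the axis cut-off `φ = φ_ε` from the energy inequality ("let us see what happens if
`ε → 0` … `I₁ → 0` … `I₂ → 0` … `I₃ → 0` … So, passing to the limit in the energy inequality, we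
find" the inequality with the cut-off `ψ⁴` of the parabolic boundary only). This file proves that
passage for the tree's form of the argument (`Seregin2020.swirl_moser_tenThirds_le`: the energy
inequality is consumed through its `L^{10/3}` consequence, where the limit is taken):

* `swirl_moser_tenThirds_le_axisCutoff` — for `Θ = Φ φ_ε` (`Φ = radialCutoff r r₁`,
  `0 < ε ≤ 1`): `∬|χΦφ_ε s(σ)|^{10/3} ≤ 3C_S² (ℛ₀ + c(L,C_T) ∬_{ϱ ≤ ε, |x| ≤ r₁}(1 + |V|^{10/3}))^{5/3}`
  with the `ε`-FREE majorant `ℛ₀ = ∬ H(σ)(8η|∇Φ|² + 2η|V|Φ|∇Φ| + |η'|Φ²)` (slice lemma of the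
  sibling module `…MoserA`, Tonelli, and `|σ| ≤ ϱ|V|`, `H ≤ Lτ²` on the shell);
* `swirl_moser_tenThirds_le_noAxisCutoff` (registered sub-goal) — `ε = 2⁻ⁿ → 0`: the shell
  integrals tend to `0` (absolute continuity, `V ∈ L^{10/3}(]t₁,hi[ × B̄(0,r₁))`, the tube
  `{ϱ ≤ ε} ∩ B̄(0,r₁)` has volume `≤ 8ε²r₁`), and Fatou on the left (`φ_ε → 1` off the axis):
  `∬ |χ Φ s(σ)|^{10/3} ≤ 3 C_S² ℛ₀^{5/3}`.
* tools: `aemeasurable_prod_of_continuousOn_offAxis`, `continuousOn_offAxis_of_eq_zero`,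
  `continuousOn_swirlMoserMain` (the `ε`-free integrand is continuous off the axis).

`(V, P)` is any member of the Seregin–Zajaczkowski class on `S = ]lo, hi[ × U`, `U` open, off the
axis, rotation invariant, containing the off-axis points of `B̄(0, r₁)` (cf.
`exists_isSmoothAxisymmetricSolutionOn_offAxis`); `H = s²` is a `C²` profile with `2s'² ≤ H''`,
`H'² ≤ 2HH''`, `H ≤ Lτ²` (`Seregin2020.exists_moserProfile`); `η = χ² ≤ 1`, `η(t₁) = 0`.

## References

* G. Seregin, Anal. Math. Phys. 10 (2020), Paper 46 = arXiv:2006.04140, proof of Thm. 2.1,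
  p. 6 (`ε → 0`). [Seregin2020]
-/

noncomputable section

open MeasureTheory Set Function Filter Topology TopologicalSpace Metric
open scoped NNReal ENNReal InnerProductSpace RealInnerProductSpace

namespace Literature.Analysis.FluidPDE.Seregin2020

open Literature.Analysis.FluidPDE Literature.Analysis.FluidPDE.SereginZajaczkowski2007
  Literature.Analysis.FluidPDE.SereginSverak2009 Literature.Analysis.FluidPDE.Seregin2020
  Literature.Analysis.FluidPDE.LeiZhang2011

/-! ### Continuity and measurability off the axis -/

/-- The form with `A = univ`: continuity on `I × {ϱ ≠ 0}` gives a.e.-measurability for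
`vol|_I ⊗ vol`. [cite: Seregin2020, proof of Thm 2.1 (arXiv p. 6), passage ε → 0: the integrands are continuous off the Lebesgue-null axis {x' = 0} (measure-theoretic form)] -/
theorem aemeasurable_prod_of_continuousOn_offAxis {β : Type*} [MeasurableSpace β]
    [TopologicalSpace β] [BorelSpace β] {I : Set ℝ} (hI : MeasurableSet I)
    {F : ℝ × EuclideanSpace ℝ (Fin 3) → β}
    (hF : ContinuousOn F (I ×ˢ {x | cylRadius x ≠ 0})) :
    AEMeasurable F ((volume.restrict I).prod (volume : Measure (EuclideanSpace ℝ (Fin 3)))) := by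
  have h := aemeasurable_prod_restrict_of_continuousOn_offAxis (β := β) hI MeasurableSet.univ
    (F := F) (by simpa only [univ_inter] using hF)
  rwa [univ_prod_univ, Measure.restrict_univ] at h

/-- **Continuity off the axis from continuity on the region of smoothness.** Let
`S = ]lo, hi[ × U` with every off-axis point of `B̄(0, r₁)` in `U`. If `F` is continuous on `S`
and vanishes at the points `(t, x)` with `r₁ < |x|`, then `F` is continuous on
`I × {ϱ ≠ 0}` for every `I ⊆ ]lo, hi[`. [cite: Seregin2020, proof of Thm 2.1 (arXiv p. 6), passage ε → 0 (functions vanishing off the cut-off region are continuous off the axis)] -/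
theorem continuousOn_offAxis_of_eq_zero {β : Type*} [TopologicalSpace β] [Zero β]
    {S : Opens (ℝ × EuclideanSpace ℝ (Fin 3))} {lo hi : ℝ} {U : Set (EuclideanSpace ℝ (Fin 3))}
    (hSU : (S : Set (ℝ × EuclideanSpace ℝ (Fin 3))) = Ioo lo hi ×ˢ U) {r₁ : ℝ}
    (hBU : ∀ x : EuclideanSpace ℝ (Fin 3), ‖x‖ ≤ r₁ → cylRadius x ≠ 0 → x ∈ U)
    {F : ℝ × EuclideanSpace ℝ (Fin 3) → β} (hF : ContinuousOn F (S : Set (ℝ × EuclideanSpace ℝ (Fin 3))))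
    (h0 : ∀ p : ℝ × EuclideanSpace ℝ (Fin 3), r₁ < ‖p.2‖ → F p = 0) {I : Set ℝ} (hI : I ⊆ Ioo lo hi) :
    ContinuousOn F (I ×ˢ {x | cylRadius x ≠ 0}) := by
  rintro p ⟨hpI, hpρ⟩
  by_cases h : ‖p.2‖ ≤ r₁
  · have hpS : p ∈ (S : Set (ℝ × EuclideanSpace ℝ (Fin 3))) := by
      rw [hSU]
      exact ⟨hI hpI, hBU p.2 h hpρ⟩
    exact (hF.continuousAt (S.isOpen.mem_nhds hpS)).continuousWithinAt
  · push Not at h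
    have hev : F =ᶠ[𝓝 p] fun _ => 0 := by
      filter_upwards [(isOpen_lt continuous_const (continuous_norm.comp continuous_snd)).mem_nhds h]
        with q hq
      exact h0 q hq
    exact (continuousAt_const.congr hev.symm).continuousWithinAt

section Assembly

variable {V : ℝ → EuclideanSpace ℝ (Fin 3) → EuclideanSpace ℝ (Fin 3)} {P : ℝ → EuclideanSpace ℝ (Fin 3) → ℝ}
  {S : Opens (ℝ × EuclideanSpace ℝ (Fin 3))} {lo hi : ℝ} {U : Set (EuclideanSpace ℝ (Fin 3))}

/-- The `ε`-free integrand `H(σ)(8η|∇Φ|² + 2η|V|Φ|∇Φ| + |η'|Φ²)` is continuous off the axis on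
`]t₁, hi[ × ℝ³` (continuous on `S`, zero outside `B̄(0, r₁)`). [folklore] -/
private theorem continuousOn_swirlMoserMain (hSU : (S : Set (ℝ × EuclideanSpace ℝ (Fin 3))) = Ioo lo hi ×ˢ U)
    (hV : IsSmoothAxisymmetricSolutionOn S V P) {r r₁ : ℝ} (hr : 0 ≤ r) (hrr₁ : r < r₁)
    (hBU : ∀ x : EuclideanSpace ℝ (Fin 3), ‖x‖ ≤ r₁ → cylRadius x ≠ 0 → x ∈ U)
    {H : ℝ → ℝ} (hH : Continuous H) {η : ℝ → ℝ} (hη : ContDiff ℝ 1 η) {t₁ : ℝ} (h1 : lo ≤ t₁) :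
    ContinuousOn (fun p : ℝ × EuclideanSpace ℝ (Fin 3) => H (swirl (V p.1) p.2) *
      (8 * η p.1 * ‖gradient (radialCutoff r r₁ : EuclideanSpace ℝ (Fin 3) → ℝ) p.2‖ ^ 2 +
        2 * η p.1 * (‖V p.1 p.2‖ * (radialCutoff r r₁ p.2 * ‖gradient (radialCutoff r r₁ : EuclideanSpace ℝ (Fin 3) → ℝ) p.2‖)) +
        |deriv η p.1| * radialCutoff r r₁ p.2 ^ 2)) (Ioo t₁ hi ×ˢ {x | cylRadius x ≠ 0}) := by
  set Φ : EuclideanSpace ℝ (Fin 3) → ℝ := radialCutoff r r₁ with hΦ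
  have hΦC : ContDiff ℝ 1 Φ := (radialCutoff_contDiff r r₁).of_le (by norm_cast)
  have cη : Continuous fun p : ℝ × EuclideanSpace ℝ (Fin 3) => η p.1 := hη.continuous.comp continuous_fst
  have cη' : Continuous fun p : ℝ × EuclideanSpace ℝ (Fin 3) => |deriv η p.1| :=
    ((hη.continuous_deriv le_rfl).comp continuous_fst).abs
  have cΦ : Continuous fun p : ℝ × EuclideanSpace ℝ (Fin 3) => Φ p.2 := hΦC.continuous.comp continuous_snd
  have cgΦ : Continuous fun p : ℝ × EuclideanSpace ℝ (Fin 3) => ‖gradient Φ p.2‖ :=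
    ((continuous_gradient_of_contDiff hΦC).comp continuous_snd).norm
  have cV : ContinuousOn (fun p : ℝ × EuclideanSpace ℝ (Fin 3) => ‖V p.1 p.2‖) (S : Set (ℝ × EuclideanSpace ℝ (Fin 3))) :=
    hV.continuousOn_velocity.norm
  have cHσ : ContinuousOn (fun p : ℝ × EuclideanSpace ℝ (Fin 3) => H (swirl (V p.1) p.2))
      (S : Set (ℝ × EuclideanSpace ℝ (Fin 3))) := hH.comp_continuousOn hV.continuousOn_swirl
  have hcont : ContinuousOn (fun p : ℝ × EuclideanSpace ℝ (Fin 3) => H (swirl (V p.1) p.2) *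
      (8 * η p.1 * ‖gradient Φ p.2‖ ^ 2 + 2 * η p.1 * (‖V p.1 p.2‖ * (Φ p.2 * ‖gradient Φ p.2‖)) +
        |deriv η p.1| * Φ p.2 ^ 2)) (S : Set (ℝ × EuclideanSpace ℝ (Fin 3))) :=
    cHσ.mul ((((continuous_const.mul cη).mul (cgΦ.pow 2)).continuousOn.add
      ((continuous_const.mul cη).continuousOn.mul (cV.mul (cΦ.mul cgΦ).continuousOn))).add
      (cη'.mul (cΦ.pow 2)).continuousOn)
  refine continuousOn_offAxis_of_eq_zero hSU hBU hcont (fun p hp => ?_) (Ioo_subset_Ioo h1 le_rfl)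
  have hK : p.2 ∉ tsupport Φ := fun h =>
    not_lt.2 (mem_closedBall_zero_iff.1 (tsupport_radialCutoff_subset hr hrr₁ h)) hp
  have h0 : Φ p.2 = 0 := radialCutoff_eq_zero hr hrr₁ hp.le
  rw [h0, gradient_eq_zero_of_notMem_tsupport hK]
  simp

/-- **The `L^{10/3}` bound with the axis cut-off `φ_ε`, right-hand side split** (Seregin 2020,
proof of Thm 2.1, arXiv p. 6, the energy inequality with `φ = φ_ε` and the bounds of
`I₁, I₂, I₃`): for `Θ = Φφ_ε`, `0 < ε ≤ 1`,
`∬ |χ Φ φ_ε s(σ)|^{10/3} ≤ 3 C_S² (ℛ₀ + (32LC_T² + 12LC_T) ∬_{ϱ ≤ ε, |x| ≤ r₁} (1 + ‖V‖ₑ^{10/3}))^{5/3}`,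
`ℛ₀ = ∬ H(σ)(8η|∇Φ|² + 2η|V|Φ|∇Φ| + |η'|Φ²)` (all integrals over `]t₁, hi[ × ℝ³`).
[cite: Seregin2020, proof of Thm 2.1 (arXiv p. 6), the terms I₁, I₂, I₃] -/
theorem swirl_moser_tenThirds_le_axisCutoff (hU : IsOpen U)
    (hSU : (S : Set (ℝ × EuclideanSpace ℝ (Fin 3))) = Ioo lo hi ×ˢ U)
    (hS : ∀ θ : ℝ, ∀ z ∈ (S : Set (ℝ × EuclideanSpace ℝ (Fin 3))), stRot θ z ∈ (S : Set (ℝ × EuclideanSpace ℝ (Fin 3))))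
    (hUρ : ∀ x ∈ U, cylRadius x ≠ 0) (hV : IsSmoothAxisymmetricSolutionOn S V P)
    {r r₁ : ℝ} (hr : 0 ≤ r) (hrr₁ : r < r₁) (hBU : ∀ x : EuclideanSpace ℝ (Fin 3), ‖x‖ ≤ r₁ → cylRadius x ≠ 0 → x ∈ U)
    {H sf : ℝ → ℝ} (hH : ContDiff ℝ 2 H) (hsf : ContDiff ℝ 1 sf) (hHs : ∀ v, H v = sf v ^ 2)
    (hs2 : ∀ v, 2 * deriv sf v ^ 2 ≤ deriv (deriv H) v)
    (hκ : ∀ v, deriv H v ^ 2 ≤ 2 * H v * deriv (deriv H) v) {L : ℝ} (hL : 0 ≤ L) (hHL : ∀ v, H v ≤ L * v ^ 2)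
    {η χ : ℝ → ℝ} (hη : ContDiff ℝ 1 η) (hηχ : ∀ s, η s = χ s ^ 2) (hη1 : ∀ s, η s ≤ 1)
    {t₁ : ℝ} (h1 : lo < t₁) (h1' : t₁ < hi) (hηt : η t₁ = 0)
    {ε : ℝ} (hε : 0 < ε) (hε1 : ε ≤ 1) {CT : ℝ} (hCT : ∀ t, |deriv Real.smoothTransition t| ≤ CT)
    {φ : EuclideanSpace ℝ (Fin 3) → ℝ} (hφ : ∀ x, φ x = Real.smoothTransition (2 / ε * cylRadius x - 1)) :
    ∫⁻ p, ‖χ p.1 * (radialCutoff r r₁ p.2 * φ p.2 * sf (swirl (V p.1) p.2))‖ₑ ^ (10 / 3 : ℝ)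
        ∂((volume.restrict (Ioo t₁ hi)).prod volume) ≤
      3 * (SNormLESNormFDerivOfEqConst ℝ (volume : Measure (EuclideanSpace ℝ (Fin 3))) 2 : ℝ≥0∞) ^ 2 *
        ((∫⁻ p, ENNReal.ofReal (H (swirl (V p.1) p.2) *
            (8 * η p.1 * ‖gradient (radialCutoff r r₁ : EuclideanSpace ℝ (Fin 3) → ℝ) p.2‖ ^ 2 +
              2 * η p.1 * (‖V p.1 p.2‖ * (radialCutoff r r₁ p.2 *
                ‖gradient (radialCutoff r r₁ : EuclideanSpace ℝ (Fin 3) → ℝ) p.2‖)) +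
              |deriv η p.1| * radialCutoff r r₁ p.2 ^ 2)) ∂((volume.restrict (Ioo t₁ hi)).prod volume)) +
          ENNReal.ofReal (32 * L * CT ^ 2 + 12 * L * CT) *
            ∫⁻ p in univ ×ˢ ({x | cylRadius x ≤ ε} ∩ closedBall (0 : EuclideanSpace ℝ (Fin 3)) r₁),
              (1 + ‖V p.1 p.2‖ₑ ^ (10 / 3 : ℝ)) ∂((volume.restrict (Ioo t₁ hi)).prod volume)) ^ (5 / 3 : ℝ) := by
  set μ' : Measure (ℝ × EuclideanSpace ℝ (Fin 3)) := (volume.restrict (Ioo t₁ hi)).prod volume with hμ'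
  set Φ : EuclideanSpace ℝ (Fin 3) → ℝ := radialCutoff r r₁ with hΦdef
  set A : Set (EuclideanSpace ℝ (Fin 3)) := {x | cylRadius x ≤ ε} ∩ closedBall (0 : EuclideanSpace ℝ (Fin 3)) r₁ with hA
  have hAm : MeasurableSet A :=
    (isClosed_le continuous_cylRadius continuous_const).measurableSet.inter isClosed_closedBall.measurableSet
  set K : ℝ≥0∞ := ENNReal.ofReal (32 * L * CT ^ 2 + 12 * L * CT) with hK
  have hH0 : ∀ v, 0 ≤ H v := fun v => by rw [hHs]; exact sq_nonneg _
  have hη0 : ∀ s, 0 ≤ η s := fun s => by rw [hηχ]; exact sq_nonneg _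
  have hIoo : Ioo t₁ hi ⊆ Ioo lo hi := Ioo_subset_Ioo h1.le le_rfl
  -- the cut-offs
  obtain ⟨hφC, hφ01, hφ0, -, hφr0, -, -, -⟩ := axisCutoff_props hε hCT hφ
  obtain ⟨Θ, hΘ⟩ : ∃ Θ : EuclideanSpace ℝ (Fin 3) → ℝ, ∀ x, Θ x = radialCutoff r r₁ x * φ x := ⟨_, fun _ => rfl⟩
  obtain ⟨hΘC, hΘc, hΘK, -, -, -, -, -⟩ := productCutoff_props hr hrr₁ hφC hφ01 hφ0 hφr0 hΘ
  have hΘU : tsupport Θ ⊆ U := fun x hx => by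
    obtain ⟨hx1, hx2⟩ := hΘK hx
    have hx2' : ε / 2 ≤ cylRadius x := hx2
    exact hBU x (mem_closedBall_zero_iff.1 hx1) (ne_of_gt (lt_of_lt_of_le (half_pos hε) hx2'))
  -- the slice functionals, and the bound with the axis cut-off
  obtain ⟨M, hM⟩ : ∃ M : ℝ → ℝ, ∀ s, M s = ∫ x, H (swirl (V s) x) * Θ x ^ 2 := ⟨_, fun _ => rfl⟩
  obtain ⟨GH, hGH⟩ : ∃ GH : ℝ → ℝ, ∀ s, GH s =
      ∫ x, deriv (deriv H) (swirl (V s) x) * ‖gradient (swirl (V s)) x‖ ^ 2 * Θ x ^ 2 := ⟨_, fun _ => rfl⟩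
  obtain ⟨Pf, hPf⟩ : ∃ Pf : ℝ → ℝ, ∀ s, Pf s = ∫ x, H (swirl (V s) x) * ‖gradient Θ x‖ ^ 2 := ⟨_, fun _ => rfl⟩
  obtain ⟨PV, hPV⟩ : ∃ PV : ℝ → ℝ, ∀ s, PV s =
      ∫ x, H (swirl (V s) x) * (‖V s x‖ * ‖gradient (fun y => Θ y ^ 2) x‖) := ⟨_, fun _ => rfl⟩
  obtain ⟨Bb, hBb⟩ : ∃ Bb : ℝ → ℝ, ∀ s, Bb s =
      ∫ x, 2 / cylRadius x * (H (swirl (V s) x) * max (fderiv ℝ (fun y => Θ y ^ 2) x (eR x)) 0) := ⟨_, fun _ => rfl⟩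
  have hmainI := swirl_moser_tenThirds_le hU hSU hS hUρ hV hH hsf hHs hs2 hκ hΘC hΘc hΘU hη hηχ h1 h1' hηt
    hM hGH hPf hPV hBb
  have eLHS : (∫⁻ p, ‖χ p.1 * (radialCutoff r r₁ p.2 * φ p.2 * sf (swirl (V p.1) p.2))‖ₑ ^ (10 / 3 : ℝ) ∂μ') =
      ∫⁻ p, ‖χ p.1 * (Θ p.2 * sf (swirl (V p.1) p.2))‖ₑ ^ (10 / 3 : ℝ) ∂μ' :=
    lintegral_congr fun p => by rw [hΘ]
  rw [eLHS]
  refine hmainI.trans ?_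
  -- measurability of the `ε`-free integrand and of `V` on the closed cylinder
  set Fm : ℝ × EuclideanSpace ℝ (Fin 3) → ℝ≥0∞ := fun p => ENNReal.ofReal (H (swirl (V p.1) p.2) *
    (8 * η p.1 * ‖gradient Φ p.2‖ ^ 2 + 2 * η p.1 * (‖V p.1 p.2‖ * (Φ p.2 * ‖gradient Φ p.2‖)) +
      |deriv η p.1| * Φ p.2 ^ 2)) with hFm
  have hFmM : AEMeasurable Fm μ' :=
    ENNReal.measurable_ofReal.comp_aemeasurable (aemeasurable_prod_of_continuousOn_offAxis measurableSet_Ioo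
      (continuousOn_swirlMoserMain hSU hV hr hrr₁ hBU hH.continuous hη h1.le))
  have hVM : AEMeasurable (uncurry V) (μ'.restrict (univ ×ˢ closedBall (0 : EuclideanSpace ℝ (Fin 3)) r₁)) := by
    refine aemeasurable_prod_restrict_of_continuousOn_offAxis measurableSet_Ioo isClosed_closedBall.measurableSet
      (hV.continuousOn_velocity.mono ?_)
    rw [hSU]
    rintro p ⟨hp1, hp2, hp3⟩
    exact ⟨hIoo hp1, hBU _ (mem_closedBall_zero_iff.1 hp2) hp3⟩
  set G : ℝ × EuclideanSpace ℝ (Fin 3) → ℝ≥0∞ := fun p => 1 + ‖V p.1 p.2‖ₑ ^ (10 / 3 : ℝ) with hG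
  have hGM : AEMeasurable ((univ ×ˢ A).indicator G) μ' := by
    refine (aemeasurable_indicator_iff (MeasurableSet.univ.prod hAm)).2 ?_
    have hle : μ'.restrict (univ ×ˢ A) ≤ μ'.restrict (univ ×ˢ closedBall (0 : EuclideanSpace ℝ (Fin 3)) r₁) :=
      Measure.restrict_mono (prod_mono Subset.rfl inter_subset_right) le_rfl
    exact ((hVM.mono_measure hle).enorm.pow_const _).const_add _
  -- the slice bound, for a.e. time
  have hslice : ∀ᵐ s ∂(volume.restrict (Ioo t₁ hi)),
      ENNReal.ofReal (4 * (η s * Pf s) + η s * PV s + η s * Bb s + |deriv η s| * M s) ≤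
        (∫⁻ x, Fm (s, x)) + K * ∫⁻ x in A, (1 + ‖V s x‖ₑ ^ (10 / 3 : ℝ)) := by
    filter_upwards [hFmM.aestronglyMeasurable.prodMk_left] with s hs
    rw [hPf, hPV, hBb, hM]
    exact swirl_moser_sliceMajorant_le V r r₁ hr hrr₁ H hH0 L hL hHL η hη0 hη1 ε hε hε1 CT hCT φ Θ hφ hΘ s hs.aemeasurable
  -- Tonelli
  have hind : (uncurry fun (s : ℝ) (x : EuclideanSpace ℝ (Fin 3)) => A.indicator (fun y => 1 + ‖V s y‖ₑ ^ (10 / 3 : ℝ)) x) =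
      (univ ×ˢ A).indicator G := by
    funext p
    by_cases hp : p.2 ∈ A
    · rw [uncurry, indicator_of_mem hp, indicator_of_mem (show p ∈ univ ×ˢ A from ⟨mem_univ _, hp⟩)]
    · rw [uncurry, indicator_of_notMem hp, indicator_of_notMem (fun h : p ∈ univ ×ˢ A => hp h.2)]
  have hℛ : (∫⁻ s in Ioo t₁ hi, ENNReal.ofReal (4 * (η s * Pf s) + η s * PV s + η s * Bb s + |deriv η s| * M s)) ≤
      (∫⁻ p, Fm p ∂μ') + K * ∫⁻ p in univ ×ˢ A, G p ∂μ' := by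
    calc (∫⁻ s in Ioo t₁ hi, ENNReal.ofReal (4 * (η s * Pf s) + η s * PV s + η s * Bb s + |deriv η s| * M s))
        ≤ ∫⁻ s in Ioo t₁ hi, ((∫⁻ x, Fm (s, x)) + K * ∫⁻ x in A, (1 + ‖V s x‖ₑ ^ (10 / 3 : ℝ))) :=
          lintegral_mono_ae hslice
      _ = (∫⁻ s in Ioo t₁ hi, ∫⁻ x, Fm (s, x)) + ∫⁻ s in Ioo t₁ hi, K * ∫⁻ x in A, (1 + ‖V s x‖ₑ ^ (10 / 3 : ℝ)) :=
          lintegral_add_left' hFmM.lintegral_prod_right' _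
      _ = (∫⁻ p, Fm p ∂μ') + K * ∫⁻ p in univ ×ˢ A, G p ∂μ' := by
          congr 1
          · exact lintegral_lintegral hFmM
          · rw [lintegral_const_mul' _ _ ENNReal.ofReal_ne_top]
            congr 1
            have e1 : ∀ s, ∫⁻ x in A, (1 + ‖V s x‖ₑ ^ (10 / 3 : ℝ)) =
                ∫⁻ x, A.indicator (fun y => 1 + ‖V s y‖ₑ ^ (10 / 3 : ℝ)) x := fun s => (lintegral_indicator hAm _).symm
            simp_rw [e1]
            have h2 := lintegral_lintegral (μ := volume.restrict (Ioo t₁ hi)) (ν := (volume : Measure (EuclideanSpace ℝ (Fin 3))))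
              (f := fun (s : ℝ) (x : EuclideanSpace ℝ (Fin 3)) => A.indicator (fun y => 1 + ‖V s y‖ₑ ^ (10 / 3 : ℝ)) x)
              (by rw [hind]; exact hGM)
            rw [h2, ← lintegral_indicator (MeasurableSet.univ.prod hAm)]
            refine lintegral_congr fun p => ?_
            have := congr_fun hind p
            simpa only [uncurry] using this
  -- arithmetic in `[0, ∞]`
  set ℛ : ℝ≥0∞ := ∫⁻ s in Ioo t₁ hi, ENNReal.ofReal (4 * (η s * Pf s) + η s * PV s + η s * Bb s + |deriv η s| * M s) with hℛdef
  set X : ℝ≥0∞ := (∫⁻ p, Fm p ∂μ') + K * ∫⁻ p in univ ×ˢ A, G p ∂μ' with hX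
  set C : ℝ≥0∞ := (SNormLESNormFDerivOfEqConst ℝ (volume : Measure (EuclideanSpace ℝ (Fin 3))) 2 : ℝ≥0∞) with hC
  calc C ^ 2 * ℛ ^ (2 / 3 : ℝ) * (2 * ℛ + ℛ / 2) ≤ C ^ 2 * X ^ (2 / 3 : ℝ) * (2 * X + X) :=
        mul_le_mul' (mul_le_mul_right (ENNReal.rpow_le_rpow hℛ (by norm_num)) _)
          (add_le_add (mul_le_mul_right hℛ _) (ENNReal.half_le_self.trans hℛ))
    _ = 3 * C ^ 2 * X ^ (5 / 3 : ℝ) := by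
        rw [show (5 / 3 : ℝ) = 2 / 3 + 1 by norm_num, ENNReal.rpow_add_of_nonneg _ _ (by norm_num) (by norm_num),
          ENNReal.rpow_one]
        ring

/-- **Removal of the axis cut-off (`ε → 0`)** (Seregin 2020, proof of Thm 2.1, arXiv p. 6:
"`I₁ → 0` … `I₂ → 0` … `I₃ → 0` … So, passing to the limit in the energy inequality, we find …"):
in the setting of `swirl_moser_tenThirds_le_axisCutoff` with moreover `χ` continuous and
`V ∈ L^{10/3}(]t₁, hi[ × B̄(0, r₁))`, the `L^{10/3}` bound holds with the cut-off `χ Φ` of the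
parabolic boundary only and the `ε`-free right-hand side:
`∬ |χ Φ s(σ)|^{10/3} ≤ 3 C_S² (∬ H(σ)(8η|∇Φ|² + 2η|V|Φ|∇Φ| + |η'|Φ²))^{5/3}` (`ε = 2⁻ⁿ`: the shell
integrals tend to `0` by absolute continuity — the tube `{ϱ ≤ ε} ∩ B̄(0,r₁)` has volume `≤ 8ε²r₁` —,
and Fatou's lemma on the left, `φ_ε → 1` off the axis).
[cite: Seregin2020, proof of Thm 2.1 (arXiv p. 6), passing to the limit ε → 0] -/
theorem swirl_moser_tenThirds_le_noAxisCutoff :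
    ∀ (V : ℝ → EuclideanSpace ℝ (Fin 3) → EuclideanSpace ℝ (Fin 3)) (P : ℝ → EuclideanSpace ℝ (Fin 3) → ℝ)
      (S : TopologicalSpace.Opens (ℝ × EuclideanSpace ℝ (Fin 3))) (lo hi : ℝ) (U : Set (EuclideanSpace ℝ (Fin 3))),
      IsOpen U → (S : Set (ℝ × EuclideanSpace ℝ (Fin 3))) = Ioo lo hi ×ˢ U →
      (∀ θ : ℝ, ∀ z ∈ (S : Set (ℝ × EuclideanSpace ℝ (Fin 3))),
        SereginZajaczkowski2007.stRot θ z ∈ (S : Set (ℝ × EuclideanSpace ℝ (Fin 3)))) →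
      (∀ x ∈ U, cylRadius x ≠ 0) → SereginZajaczkowski2007.IsSmoothAxisymmetricSolutionOn S V P →
    ∀ (r r₁ : ℝ), 0 ≤ r → r < r₁ → (∀ x : EuclideanSpace ℝ (Fin 3), ‖x‖ ≤ r₁ → cylRadius x ≠ 0 → x ∈ U) →
    ∀ (H sf : ℝ → ℝ), ContDiff ℝ 2 H → ContDiff ℝ 1 sf → (∀ v, H v = sf v ^ 2) →
      (∀ v, 2 * deriv sf v ^ 2 ≤ deriv (deriv H) v) → (∀ v, deriv H v ^ 2 ≤ 2 * H v * deriv (deriv H) v) →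
    ∀ (L : ℝ), 0 ≤ L → (∀ v, H v ≤ L * v ^ 2) →
    ∀ (η χ : ℝ → ℝ), ContDiff ℝ 1 η → Continuous χ → (∀ s, η s = χ s ^ 2) → (∀ s, η s ≤ 1) →
    ∀ (t₁ : ℝ), lo < t₁ → t₁ < hi → η t₁ = 0 →
    (∫⁻ p in Ioo t₁ hi ×ˢ Metric.closedBall (0 : EuclideanSpace ℝ (Fin 3)) r₁, ‖V p.1 p.2‖ₑ ^ (10 / 3 : ℝ)
      ∂((volume : Measure ℝ).prod (volume : Measure (EuclideanSpace ℝ (Fin 3))))) < ⊤ →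
    ∫⁻ p, ‖χ p.1 * (radialCutoff r r₁ p.2 * sf (swirl (V p.1) p.2))‖ₑ ^ (10 / 3 : ℝ)
        ∂((volume.restrict (Ioo t₁ hi)).prod volume) ≤
      3 * (SNormLESNormFDerivOfEqConst ℝ (volume : Measure (EuclideanSpace ℝ (Fin 3))) 2 : ℝ≥0∞) ^ 2 *
        (∫⁻ p, ENNReal.ofReal (H (swirl (V p.1) p.2) *
            (8 * η p.1 * ‖gradient (radialCutoff r r₁ : EuclideanSpace ℝ (Fin 3) → ℝ) p.2‖ ^ 2 +
              2 * η p.1 * (‖V p.1 p.2‖ * (radialCutoff r r₁ p.2 *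
                ‖gradient (radialCutoff r r₁ : EuclideanSpace ℝ (Fin 3) → ℝ) p.2‖)) +
              |deriv η p.1| * radialCutoff r r₁ p.2 ^ 2)) ∂((volume.restrict (Ioo t₁ hi)).prod volume)) ^ (5 / 3 : ℝ) := by
  intro V P S lo hi U hU hSU hS hUρ hV r r₁ hr hrr₁ hBU H sf hH hsf hHs hs2 hκ L hL hHL η χ hη hχ hηχ hη1 t₁ h1 h1' hηt hVint
  obtain ⟨CT, -, hCT⟩ := LeiZhang2011.exists_abs_deriv_smoothTransition_le
  set μ' : Measure (ℝ × EuclideanSpace ℝ (Fin 3)) := (volume.restrict (Ioo t₁ hi)).prod volume with hμ'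
  set Φ : EuclideanSpace ℝ (Fin 3) → ℝ := radialCutoff r r₁ with hΦdef
  set ℛ₀ : ℝ≥0∞ := ∫⁻ p, ENNReal.ofReal (H (swirl (V p.1) p.2) * (8 * η p.1 * ‖gradient Φ p.2‖ ^ 2 +
    2 * η p.1 * (‖V p.1 p.2‖ * (Φ p.2 * ‖gradient Φ p.2‖)) + |deriv η p.1| * Φ p.2 ^ 2)) ∂μ' with hℛ₀
  set K : ℝ≥0∞ := ENNReal.ofReal (32 * L * CT ^ 2 + 12 * L * CT) with hK
  set C : ℝ≥0∞ := 3 * (SNormLESNormFDerivOfEqConst ℝ (volume : Measure (EuclideanSpace ℝ (Fin 3))) 2 : ℝ≥0∞) ^ 2 with hC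
  have hCtop : C ≠ ∞ := ENNReal.mul_ne_top (by norm_num) (ENNReal.pow_ne_top ENNReal.coe_ne_top)
  have hr₁ : 0 ≤ r₁ := hr.trans hrr₁.le
  -- the sequence `ε_n = 2⁻ⁿ` and its axis cut-offs
  set ε : ℕ → ℝ := fun n => (1 / 2 : ℝ) ^ n with hεdef
  have hε0 : ∀ n, 0 < ε n := fun n => by positivity
  have hε1 : ∀ n, ε n ≤ 1 := fun n => pow_le_one₀ (by norm_num) (by norm_num)
  have hεt : Tendsto ε atTop (𝓝 0) := tendsto_pow_atTop_nhds_zero_of_lt_one (by norm_num) (by norm_num)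
  obtain ⟨φ, hφ⟩ : ∃ φ : ℕ → EuclideanSpace ℝ (Fin 3) → ℝ,
      ∀ n x, φ n x = Real.smoothTransition (2 / ε n * cylRadius x - 1) := ⟨_, fun _ _ => rfl⟩
  set A : ℕ → Set (EuclideanSpace ℝ (Fin 3)) := fun n => {x | cylRadius x ≤ ε n} ∩ closedBall 0 r₁ with hA
  have hAm : ∀ n, MeasurableSet (A n) := fun n =>
    (isClosed_le continuous_cylRadius continuous_const).measurableSet.inter isClosed_closedBall.measurableSet
  set G : ℝ × EuclideanSpace ℝ (Fin 3) → ℝ≥0∞ := fun p => 1 + ‖V p.1 p.2‖ₑ ^ (10 / 3 : ℝ) with hG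
  set E : ℕ → ℝ≥0∞ := fun n => ∫⁻ p in univ ×ˢ A n, G p ∂μ' with hE
  set f : ℕ → ℝ × EuclideanSpace ℝ (Fin 3) → ℝ≥0∞ := fun n p =>
    ‖χ p.1 * (Φ p.2 * φ n p.2 * sf (swirl (V p.1) p.2))‖ₑ ^ (10 / 3 : ℝ) with hf
  -- (1) the bound for each `n`
  have hbound : ∀ n, ∫⁻ p, f n p ∂μ' ≤ C * (ℛ₀ + K * E n) ^ (5 / 3 : ℝ) := fun n =>
    swirl_moser_tenThirds_le_axisCutoff hU hSU hS hUρ hV hr hrr₁ hBU hH hsf hHs hs2 hκ hL hHL hη hηχ hη1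
      h1 h1' hηt (hε0 n) (hε1 n) hCT (hφ n)
  -- (2) the shell integrals tend to zero
  have hEt : Tendsto E atTop (𝓝 0) := by
    set B : Set (EuclideanSpace ℝ (Fin 3)) := closedBall (0 : EuclideanSpace ℝ (Fin 3)) r₁ with hB
    have hBm : MeasurableSet (univ ×ˢ B : Set (ℝ × EuclideanSpace ℝ (Fin 3))) := MeasurableSet.univ.prod measurableSet_closedBall
    set F : ℝ × EuclideanSpace ℝ (Fin 3) → ℝ≥0∞ := (univ ×ˢ B).indicator G with hF
    have hrestr : μ'.restrict (univ ×ˢ B) =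
        ((volume : Measure ℝ).prod (volume : Measure (EuclideanSpace ℝ (Fin 3)))).restrict (Ioo t₁ hi ×ˢ B) := by
      rw [hμ', ← Measure.prod_restrict, Measure.restrict_univ, Measure.prod_restrict]
    have hFfin : ∫⁻ p, F p ∂μ' ≠ ∞ := by
      rw [hF, lintegral_indicator hBm, hG, lintegral_add_left measurable_const, setLIntegral_const, one_mul]
      refine ENNReal.add_ne_top.2 ⟨?_, ?_⟩
      · rw [hμ', Measure.prod_prod, Measure.restrict_apply_univ, Real.volume_Ioo]
        exact ENNReal.mul_ne_top ENNReal.ofReal_ne_top measure_closedBall_lt_top.ne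
      · rw [show (∫⁻ p in univ ×ˢ B, ‖V p.1 p.2‖ₑ ^ (10 / 3 : ℝ) ∂μ') =
            ∫⁻ p in Ioo t₁ hi ×ˢ B, ‖V p.1 p.2‖ₑ ^ (10 / 3 : ℝ) ∂((volume : Measure ℝ).prod volume) by rw [hrestr]]
        exact hVint.ne
    have hmeas : Tendsto (fun n => μ' (univ ×ˢ A n)) atTop (𝓝 0) := by
      have hle : ∀ n, μ' (univ ×ˢ A n) ≤ ENNReal.ofReal (hi - t₁) * ENNReal.ofReal (8 * ε n ^ 2 * r₁) := fun n => by
        rw [hμ', Measure.prod_prod, Measure.restrict_apply_univ, Real.volume_Ioo]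
        refine mul_le_mul_right ((measure_mono ?_).trans (volume_thinCylinder_le (hε0 n).le hr₁)) _
        rintro x ⟨hx1, hx2⟩
        refine ⟨?_, pow_le_pow_left₀ (norm_nonneg x) (mem_closedBall_zero_iff.1 hx2) 2⟩
        rw [← cylRadius_sq]
        exact pow_le_pow_left₀ (cylRadius_nonneg x) (show cylRadius x ≤ ε n from hx1) 2
      have hlim : Tendsto (fun n => ENNReal.ofReal (hi - t₁) * ENNReal.ofReal (8 * ε n ^ 2 * r₁)) atTop (𝓝 0) := by
        have hreal : Tendsto (fun n => 8 * ε n ^ 2 * r₁) atTop (𝓝 0) := by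
          have := ((hεt.pow 2).const_mul 8).mul_const r₁
          simpa using this
        have h3 := ENNReal.Tendsto.const_mul (ENNReal.tendsto_ofReal hreal) (Or.inr ENNReal.ofReal_ne_top)
          (a := ENNReal.ofReal (hi - t₁))
        rwa [ENNReal.ofReal_zero, mul_zero] at h3
      exact tendsto_of_tendsto_of_tendsto_of_le_of_le tendsto_const_nhds hlim (fun n => zero_le) hle
    have h := tendsto_setLIntegral_zero hFfin hmeas
    refine (tendsto_congr fun n => ?_).1 h
    refine setLIntegral_congr_fun (MeasurableSet.univ.prod (hAm n)) fun p hp => ?_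
    exact indicator_of_mem (show p ∈ univ ×ˢ B from ⟨mem_univ _, hp.2.2⟩) _
  -- (3) the right-hand sides converge
  have hRHS : Tendsto (fun n => C * (ℛ₀ + K * E n) ^ (5 / 3 : ℝ)) atTop (𝓝 (C * ℛ₀ ^ (5 / 3 : ℝ))) := by
    have hKE : Tendsto (fun n => K * E n) atTop (𝓝 0) := by
      have := ENNReal.Tendsto.const_mul hEt (Or.inr ENNReal.ofReal_ne_top) (a := K)
      rwa [mul_zero] at this
    have hsum : Tendsto (fun n => ℛ₀ + K * E n) atTop (𝓝 ℛ₀) := by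
      have : Tendsto (fun n => ℛ₀ + K * E n) atTop (𝓝 (ℛ₀ + 0)) := tendsto_const_nhds.add hKE
      rwa [add_zero] at this
    have hpow := ((ENNReal.continuous_rpow_const (y := (5 / 3 : ℝ))).tendsto ℛ₀).comp hsum
    exact ENNReal.Tendsto.const_mul hpow (Or.inr hCtop)
  -- (4) Fatou on the left
  have hfM : ∀ n, AEMeasurable (f n) μ' := by
    intro n
    obtain ⟨hφC, -, -, -, -, -, -, -⟩ := axisCutoff_props (hε0 n) hCT (hφ n)
    have hcont : ContinuousOn (fun p : ℝ × EuclideanSpace ℝ (Fin 3) => χ p.1 * (Φ p.2 * φ n p.2 * sf (swirl (V p.1) p.2)))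
        (S : Set (ℝ × EuclideanSpace ℝ (Fin 3))) :=
      (hχ.comp continuous_fst).continuousOn.mul
        ((((radialCutoff_contDiff r r₁ (n := 0)).continuous.comp continuous_snd).mul
          (hφC.continuous.comp continuous_snd)).continuousOn.mul
          (hsf.continuous.comp_continuousOn hV.continuousOn_swirl))
    have hoff := continuousOn_offAxis_of_eq_zero hSU hBU hcont (fun p hp => by
      show χ p.1 * (Φ p.2 * φ n p.2 * sf (swirl (V p.1) p.2)) = 0
      rw [show Φ p.2 = 0 from radialCutoff_eq_zero hr hrr₁ hp.le]
      simp) (Ioo_subset_Ioo h1.le le_rfl)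
    exact ((aemeasurable_prod_of_continuousOn_offAxis measurableSet_Ioo hoff).enorm.pow_const _)
  have hae : ∀ᵐ p ∂μ', (‖χ p.1 * (Φ p.2 * sf (swirl (V p.1) p.2))‖ₑ ^ (10 / 3 : ℝ)) = liminf (fun n => f n p) atTop := by
    have h0 : μ' (univ ×ˢ {x : EuclideanSpace ℝ (Fin 3) | cylRadius x = 0}) = 0 := by
      rw [hμ', Measure.prod_prod, volume_setOf_cylRadius_eq_zero, mul_zero]
    filter_upwards [measure_eq_zero_iff_ae_notMem.1 h0] with p hp
    have hρ : 0 < cylRadius p.2 := lt_of_le_of_ne (cylRadius_nonneg _) fun h => hp ⟨mem_univ _, h.symm⟩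
    have hev : ∀ᶠ n in atTop, f n p = ‖χ p.1 * (Φ p.2 * sf (swirl (V p.1) p.2))‖ₑ ^ (10 / 3 : ℝ) := by
      filter_upwards [hεt.eventually_le_const hρ] with n hn
      have h1n : φ n p.2 = 1 := (axisCutoff_props (hε0 n) hCT (hφ n)).2.2.2.1 p.2 hn
      simp only [hf, h1n, mul_one]
    rw [liminf_congr hev, liminf_const]
  calc (∫⁻ p, ‖χ p.1 * (Φ p.2 * sf (swirl (V p.1) p.2))‖ₑ ^ (10 / 3 : ℝ) ∂μ')
      = ∫⁻ p, liminf (fun n => f n p) atTop ∂μ' := lintegral_congr_ae hae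
    _ ≤ liminf (fun n => ∫⁻ p, f n p ∂μ') atTop := lintegral_liminf_le' hfM
    _ ≤ liminf (fun n => C * (ℛ₀ + K * E n) ^ (5 / 3 : ℝ)) atTop := liminf_le_liminf (Eventually.of_forall hbound)
    _ = C * ℛ₀ ^ (5 / 3 : ℝ) := hRHS.liminf_eq

end Assembly

end Literature.Analysis.FluidPDE.Seregin2020

end
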